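import Literature.AlgebraicGeometry.Markman2025.DescentExponentArithmetic

/-!
# Markman 2025 — LEMMA 9.3.5 («the object `𝒢 ⊗ Dᵃ` admits a `Ḡ`-linearization») and the paragraph before it
# (p. 84 L9–20: «The group `G` has exponent `n = d + 1`», the chosen isomorphisms `L_gⁿ ≅ 𝒪`): the exponent
# bookkeeping of the printed proof, AS PRINTED, kernel-checked

E. Markman: [M] *Cycles on abelian 2n-folds of Weil type from secant sheaves on abelian n-folds*,
arXiv:2502.03415 **v2** (2025-06-08), bib `Markman2025SecantWeil` — UNREFEREED PREPRINT. «p. N L m» = PyMuPDF line `m`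
of page `N` of the public v2 PDF (sha256/16 `8155aa33870069b8`), text layer re-extracted at seat lit-w-markman g21
(pub-hsemireg LIT-W, 2026-08-25; sheet `LOCATOR-SHEET-MARKMAN.md` §2 carries §9.3 verbatim, §66 this file); the two
displays of the proof (p. 84 L24–32) were read BY EYE on the render `r_mar25v2_p84_L9-37.png` of this seat
(`HOME/lit/Markman-renders-litw-markman-g21/`). This file is the LAST elementary step of the descent of [M] §9.3 not yet
in the tree: `DescentExponentArithmetic.lean` proves the sentence p. 84 L18–20 (existence of the positive exponent `a`
with `a·r ≡ −1 (mod n)` iff `d` is even), `EquivarianceGroupTranslationProjection.lean` the group `G ≅ Ḡ` and its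
exponent, `EquivariantSemiregularityDescent.lean` Lemma 9.3.11; here: WHY `a·r ≡ −1 (mod n)` is what makes
`𝒢 ⊗ det(𝒢)ᵃ` descend (rows M-Mk6 ∕ W1 «twisted objects ∕ derived autoequivalence orbits» of the LIT-W table).

## What is printed (verbatim, v2 p. 84)

* L9–18: «Given `g ∈ G`, let `(x_g, L_g) ∈ (X × X̂) × Pic⁰(X × X̂)` be the point, such that the autoequivalence `g` of
  `D^b(X × X̂)` is isomorphic to `L_g ⊗ τ_{x_g,*}`. The group `G` has exponent `n = d + 1`. We identify `G` with the
  corresponding subgroup of `X × X̂ × Pic⁰(X × X̂)`. This identification provides a choice of an isomorphism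
  `L_gⁿ ≅ 𝒪_{X×X̂}`, for every `g ∈ G`, since `gⁿ = L_gⁿ ⊗ τ_{nx_g,*}` is the identity endofunctor and `nx_g` is the
  identity element of the group `X × X̂`, so that `τⁿ_{x_g,*}` is the identity endofunctor.» (display-free; the
  sub/superscripts `L_gⁿ`, `τ_{nx_g,*}`, `τⁿ_{x_g,*}` read by eye)
* L18–20: «The rank `r` of `E` is `8d`. If `d` is even, then `gcd(r, n) = gcd(8d, d + 1) = 1` and there exists a
  positive integer `a`, such that `ar ≡ −1` modulo `n`. Set `D := det(𝒢)`.» (= `DescentExponentArithmetic`.)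
* LEMMA 9.3.5 (L21): «If `d` is even,²⁵ then the object `𝒢 ⊗ Dᵃ` admits a `Ḡ`-linearization.»
* Proof (L22–37): «The linearization isomorphisms `λ_g : 𝒢 → τ_{x_g,*}(𝒢) ⊗ L_g`, `g ∈ G`, induce the isomorphisms
  `∧ʳλ_g : D → τ_{x_g,*}(D) ⊗ L_gʳ`,  `λ_g ⊗ (∧ʳλ_g)ᵃ : 𝒢 ⊗ Dᵃ → τ_{x_g,*}(𝒢 ⊗ Dᵃ) ⊗ L_g^{ar+1}`.
  Now, tensorization with `L_g^{ar+1}` is a power of the identity endofunctor, as noted above. Hence, `λ ⊗ (∧ʳλ)ᵃ` is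
  a `Ḡ`-linearization for `𝒢 ⊗ Dᵃ`. □» (print: calligraphic `𝒢` for the object, italic `G` for the group)
* Footnote 25 (L63–68): «Note that `ℚ(√−d) = ℚ(√−4d)`, so the assumption that `d` is even does not restrict the
  compex [sic] multiplications we can treat.» (= `DescentExponentArithmetic.adjoin_I_mul_sqrt_four_mul`.)
* Context: p. 84 L46–47 «The `G`-linearization `λ` of `𝒢` …»; `r = 8d` is the rank of the reflexive sheaf `𝓔 = (𝒢¹)^*` (p. 84 L18, L52); `Ḡ` = the projection of `G` to `X × X̂` (p. 82 L45–46),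
  `p : G → Ḡ` an isomorphism (LEMMA 9.3.3), `q : G → Ĝ ⊂ Pic⁰(X × X̂)` the other projection (LEMMA 9.3.4, proof).

## The model and what is proved (0 `def`, 0 named fact, 0 sorry; nothing geometric)

* §A (p. 84 L9–18). `Γ` = an abstract group for `G`; `P` = a commutative group written multiplicatively for
  `Pic⁰(X × X̂)` (or `Pic`) under `⊗`; `q : Γ →* P` the projection `g ↦ L_g` (a homomorphism because `G` is identified
  with a subgroup of the GROUP `X × X̂ × Pic⁰(X × X̂)`, p. 84 L10–11 — BY VALUE). «`G` has exponent `n`» ⟹ `L_gⁿ = 1`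
  (`lineBundlePart_pow_exponent`, `lineBundlePart_pow_eq_one`). The sentence «`gⁿ = L_gⁿ ⊗ τ_{nx_g,*}`» at the level
  of the underlying self-maps of a set `O` of objects on which `P` acts by tensorization (`MulAction P O`) and
  `X × X̂ = A` acts by translation push-forward (`AddAction A O`), the two actions commuting (a line bundle in `Pic⁰` is
  translation invariant — BY VALUE, hypothesis `hcomm`): `(L • τ_x)^[n] = Lⁿ • τ_{n•x}` (`autoequivalence_iterate`,
  literally the printed `gⁿ = L_gⁿ ⊗ τ_{nx_g,*}`), and
  «`nx_g` is the identity element … so that `τⁿ_{x_g,*}` is the identity» (`translation_iterate_eq_id`).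
* §B (the proof of LEMMA 9.3.5). The EXPONENTS of `L_g`: `λ_g` carries `L_g¹`, `∧ʳλ_g` carries `L_gʳ` (degree-`r`
  homogeneity of the determinant of a rank-`r` object — kernel shadow `det_twist_scalar`: `det(c·φ) = cʳ·det φ` for an
  `r × r` matrix, Mathlib `Matrix.det_smul`; the sheaf statement `det(τ(𝒢) ⊗ L) = τ(D) ⊗ Lʳ` is BY VALUE), so
  `λ_g ⊗ (∧ʳλ_g)ᵃ` carries `L_g · (L_gʳ)ᵃ = L_g^{ar+1}` (`twist_exponent`). «`ar ≡ −1` modulo `n`» ⟺ `n ∣ ar + 1`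
  (`dvd_iff_modEq`), hence `L_g^{ar+1} = (L_gⁿ)^{(ar+1)/n} = 1` (`twist_pow_eq_one`) and «tensorization with
  `L_g^{ar+1}` is a power of the identity endofunctor»: `(L •)^[ar+1] = ((L •)^[n])^[(ar+1)/n]` with `(L •)^[n] =
  (Lⁿ •) = id` (`tensorization_iterate_eq_iterate_pow`, `tensorization_iterate_eq_id`). CONSEQUENCE at the level of
  ISOMORPHISM CLASSES (the cocycle condition of «Hence, `λ ⊗ (∧ʳλ)ᵃ` is a `Ḡ`-linearization» is BY VALUE — it rests on
  the chosen isomorphisms `L_gⁿ ≅ 𝒪` of L12–14): in any commutative monoid `K` of classes under `⊗` with `τ : K →* K`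
  the push-forward by `τ_{x_g}`, if `τ F = L·F` (the class of `λ_g`), `τ D = Lʳ·D` (of `∧ʳλ_g`), `Lⁿ = 1` and
  `n ∣ ar + 1`, then `τ(F·Dᵃ) = F·Dᵃ` — the class of `𝒢 ⊗ Dᵃ` is `Ḡ`-INVARIANT (`class_twist_invariant`); assembled
  with `DescentExponentArithmetic.exists_descentExponent_of_even` (`r = 8d`, `n = d + 1`, `d` even): ONE positive `a`
  works for every `g` (`lemma935_classInvariant_of_even`), and for `d` odd no exponent exists
  (`DescentExponentArithmetic.exists_descentExponent_iff_even`) — footnote 25's `d ↦ 4d` is the printed remedy.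
BY VALUE (not modelled): `D^b(X × X̂)`, Orlov's equivalence, linearizations as DATA (only exponents and classes are
tracked), `det` of a complex, `τ_{x,*}` on sheaves, the identification of `G` with a subgroup of
`X × X̂ × Pic⁰(X × X̂)`. Honest framing: bookkeeping of a printed elementary step; nothing here says that any object of
the pub-hsemireg cell is semiregular or descends, or that HC ∕ HC_CM ∕ HC_AV is proved; no theorem of [M] is re-proved
beyond its displayed exponent arithmetic.
-/

namespace Literature.AlgebraicGeometry.Markman2025.Lemma935

/-! ### §A — p. 84 L9–18: the exponent of `G` kills the line-bundle parts `L_g` -/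

section ParagraphBefore

variable {Γ : Type*} [Group Γ] {P : Type*} [CommGroup P]

/-- «The group `G` has exponent `n = d + 1`. … a choice of an isomorphism `L_gⁿ ≅ 𝒪_{X×X̂}`, for every `g ∈ G`, since
`gⁿ = L_gⁿ ⊗ τ_{nx_g,*}` is the identity endofunctor» — for the projection `q : g ↦ L_g` (a group homomorphism to
`Pic⁰`, written multiplicatively): `L_g ^ exponent(G) = 1`. [cite: Markman2025SecantWeil, §9.3, v2 p. 84 L10–16] -/
theorem lineBundlePart_pow_exponent (q : Γ →* P) (g : Γ) : q g ^ Monoid.exponent Γ = 1 := by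
  rw [← map_pow, Monoid.pow_exponent_eq_one, map_one]

/-- The same with the printed value of the exponent, «`n = d + 1`»: if `exponent(G) = n` then `L_gⁿ = 1` for every
`g`. [cite: Markman2025SecantWeil, §9.3, v2 p. 84 L10–16] -/
theorem lineBundlePart_pow_eq_one (q : Γ →* P) {n : ℕ} (hn : Monoid.exponent Γ = n) (g : Γ) : q g ^ n = 1 := by
  rw [← hn]; exact lineBundlePart_pow_exponent q g

variable {A : Type*} [AddCommGroup A] {O : Type*} [MulAction P O] [AddAction A O]

/-- «`gⁿ = L_gⁿ ⊗ τ_{nx_g,*}`» — for `g = L ⊗ τ_{x,*}` acting on objects, with tensorization by `L ∈ Pic⁰` commuting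
with translation push-forward (`Pic⁰` is translation invariant, BY VALUE): the `n`-th iterate of `F ↦ L ⊗ τ_x(F)` is
`F ↦ Lⁿ ⊗ τ_{n·x}(F)`. [cite: Markman2025SecantWeil, §9.3, v2 p. 84 L15–16] -/
theorem autoequivalence_iterate (L : P) (x : A) (hcomm : ∀ F : O, x +ᵥ (L • F) = L • (x +ᵥ F)) (n : ℕ) :
    (fun F : O => L • (x +ᵥ F))^[n] = fun F : O => L ^ n • ((n • x) +ᵥ F) := by
  have hc : Function.Commute (fun F : O => L • F) (fun F : O => x +ᵥ F) := fun F => (hcomm F).symm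
  have h : (fun F : O => L • (x +ᵥ F))^[n] = (fun F : O => L • F)^[n] ∘ (fun F : O => x +ᵥ F)^[n] :=
    hc.comp_iterate n
  rw [h, smul_iterate, vadd_iterate]
  rfl

/-- «… and `nx_g` is the identity element of the group `X × X̂`, so that `τⁿ_{x_g,*}` is the identity endofunctor.»
[cite: Markman2025SecantWeil, §9.3, v2 p. 84 L16–18] -/
theorem translation_iterate_eq_id (x : A) {n : ℕ} (hx : n • x = 0) : (fun F : O => x +ᵥ F)^[n] = id := by
  rw [vadd_iterate, hx]
  funext F
  exact zero_vadd A F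

/-- Consequently: if moreover `gⁿ` is the identity (exponent `n`) and `n·x_g = 0`, then tensorization with
`L_gⁿ` fixes every object — on the regular `P`-orbit this reads `L_gⁿ = 1`, the chosen isomorphism `L_gⁿ ≅ 𝒪`.
[cite: Markman2025SecantWeil, §9.3, v2 p. 84 L12–18] -/
theorem lineBundlePart_pow_smul_eq_self (L : P) (x : A) (hcomm : ∀ F : O, x +ᵥ (L • F) = L • (x +ᵥ F)) {n : ℕ}
    (hx : n • x = 0) (hg : (fun F : O => L • (x +ᵥ F))^[n] = id) (F : O) : L ^ n • F = F := by
  have h := congrFun (autoequivalence_iterate L x hcomm n) F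
  rw [hg, hx] at h
  simpa using h.symm

end ParagraphBefore

/-! ### §B — the proof of LEMMA 9.3.5: the exponent `ar + 1` -/

section Proof

/-- «`∧ʳλ_g : D → τ_{x_g,*}(D) ⊗ L_gʳ`» — the determinant of a rank-`r` object is homogeneous of degree `r` in a twist:
kernel shadow on an `r × r` matrix, `det(c·φ) = cʳ·det(φ)` (Mathlib `Matrix.det_smul`; the sheaf statement
`det(τ(𝒢) ⊗ L_g) = τ(D) ⊗ L_gʳ` is BY VALUE). [cite: Markman2025SecantWeil, Lemma 9.3.5 (proof), v2 p. 84 L22–27 (degree-`r` homogeneity of `det`, shadow)] -/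
theorem det_twist_scalar {R : Type*} [CommRing R] {r : ℕ} (c : R) (φ : Matrix (Fin r) (Fin r) R) :
    (c • φ).det = c ^ r * φ.det := by
  rw [Matrix.det_smul, Fintype.card_fin]

variable {P : Type*} [CommMonoid P]

/-- «`λ_g ⊗ (∧ʳλ_g)ᵃ : 𝒢 ⊗ Dᵃ → τ_{x_g,*}(𝒢 ⊗ Dᵃ) ⊗ L_g^{ar+1}`» — the exponent of `L_g`: `L · (Lʳ)ᵃ = L^{ar+1}`.
[cite: Markman2025SecantWeil, Lemma 9.3.5 (proof), v2 p. 84 L28–32] -/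
theorem twist_exponent (L : P) (r a : ℕ) : L * (L ^ r) ^ a = L ^ (a * r + 1) := by
  rw [← pow_mul, pow_succ', mul_comm r a]

/-- «`ar ≡ −1` modulo `n`» (p. 84 L20, the integer congruence proved in `DescentExponentArithmetic`) says exactly
`n ∣ ar + 1`. [cite: Markman2025SecantWeil, §9.3, v2 p. 84 L19–20] -/
theorem dvd_iff_modEq (a r n : ℕ) : n ∣ a * r + 1 ↔ ((a : ℤ) * r) ≡ -1 [ZMOD n] := by
  rw [Int.modEq_iff_dvd, show (-1 : ℤ) - (a : ℤ) * r = -((a * r + 1 : ℕ) : ℤ) by push_cast; ring, Int.dvd_neg,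
    Int.natCast_dvd_natCast]

/-- Hence `L_g^{ar+1} = 1`: from `L_gⁿ = 1` (p. 84 L12–14) and `n ∣ ar + 1`.
[cite: Markman2025SecantWeil, Lemma 9.3.5 (proof), v2 p. 84 L33–35] -/
theorem twist_pow_eq_one (L : P) {n a r : ℕ} (hL : L ^ n = 1) (hn : n ∣ a * r + 1) : L ^ (a * r + 1) = 1 := by
  obtain ⟨m, hm⟩ := hn
  rw [hm, pow_mul, hL, one_pow]

variable {O : Type*} [MulAction P O]

/-- «Now, tensorization with `L_g^{ar+1}` is a power of the identity endofunctor, as noted above.» — literally: with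
`n ∣ ar + 1`, the `(ar+1)`-fold iterate of `F ↦ L ⊗ F` is the `((ar+1)/n)`-fold iterate of its `n`-fold iterate,
and the `n`-fold iterate is `F ↦ Lⁿ ⊗ F`. [cite: Markman2025SecantWeil, Lemma 9.3.5 (proof), v2 p. 84 L33–35] -/
theorem tensorization_iterate_eq_iterate_pow (L : P) {n a r : ℕ} (hn : n ∣ a * r + 1) :
    (fun F : O => L • F)^[a * r + 1] = ((fun F : O => L ^ n • F))^[(a * r + 1) / n] := by
  rcases Nat.eq_zero_or_pos n with rfl | hn0
  · exact absurd (zero_dvd_iff.mp hn) (by omega)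
  · obtain ⟨m, hm⟩ := hn
    rw [hm, Nat.mul_div_cancel_left m hn0, Function.iterate_mul, smul_iterate]

/-- … and that power of the identity IS the identity once `L_gⁿ ≅ 𝒪` is fixed: `(L ⊗ ·)^[ar+1] = id`, i.e.
`L^{ar+1} ⊗ F = F` for every object `F`. [cite: Markman2025SecantWeil, Lemma 9.3.5 (proof), v2 p. 84 L33–35] -/
theorem tensorization_iterate_eq_id (L : P) {n a r : ℕ} (hL : L ^ n = 1) (hn : n ∣ a * r + 1) :
    (fun F : O => L • F)^[a * r + 1] = id := by
  rw [smul_iterate, twist_pow_eq_one L hL hn]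
  funext F
  exact one_smul P F

variable {K : Type*} [CommMonoid K]

/-- «Hence, `λ ⊗ (∧ʳλ)ᵃ` is a `Ḡ`-linearization for `𝒢 ⊗ Dᵃ`» — at the level of ISOMORPHISM CLASSES (the cocycle
datum BY VALUE): in a commutative monoid `K` of classes under `⊗`, with `τ = τ_{x_g,*} : K →* K`, if `τF = L·F`
(the class of `λ_g`), `τD = Lʳ·D` (the class of `∧ʳλ_g`), `Lⁿ = 1` and `n ∣ ar + 1`, then the class `F·Dᵃ` is fixed
by `τ`. [cite: Markman2025SecantWeil, Lemma 9.3.5, v2 p. 84 L21–37 (class-level consequence)] -/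
theorem class_twist_invariant (τ : K →* K) {L F D : K} {n a r : ℕ} (hF : τ F = L * F) (hD : τ D = L ^ r * D)
    (hL : L ^ n = 1) (hn : n ∣ a * r + 1) : τ (F * D ^ a) = F * D ^ a := by
  rw [map_mul, map_pow, hF, hD, mul_pow, mul_mul_mul_comm, twist_exponent, twist_pow_eq_one L hL hn, one_mul]

/-- `DescentExponentArithmetic.exists_descentExponent_of_even` in divisibility form: for `d` even there is a
positive `a` with `(d + 1) ∣ a·8d + 1`; private restatement. [folklore] -/
private theorem exists_descentExponent_dvd_of_even {d : ℕ} (hd : Even d) :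
    ∃ a : ℕ, 0 < a ∧ (d + 1) ∣ a * (8 * d) + 1 := by
  obtain ⟨a, ha, h⟩ := exists_descentExponent_of_even hd
  exact ⟨a, ha, (dvd_iff_modEq a (8 * d) (d + 1)).mpr h⟩

/-- LEMMA 9.3.5 with its printed hypothesis, class level: «If `d` is even, then the object `𝒢 ⊗ Dᵃ` admits a
`Ḡ`-linearization» — for `r = 8d` and exponent `n = d + 1` with `d` EVEN there is ONE positive integer `a`
(`DescentExponentArithmetic.exists_descentExponent_of_even`) such that, for every `g` (every `τ`, `L` with
`L^{d+1} = 1`, and classes `F`, `D` twisted by `L`, `L^{8d}`), the class `F·Dᵃ` is `τ`-invariant.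
[cite: Markman2025SecantWeil, Lemma 9.3.5, v2 p. 84 L18–37] -/
theorem lemma935_classInvariant_of_even {d : ℕ} (hd : Even d) :
    ∃ a : ℕ, 0 < a ∧ ∀ (τ : K →* K) (L F D : K), τ F = L * F → τ D = L ^ (8 * d) * D → L ^ (d + 1) = 1 →
      τ (F * D ^ a) = F * D ^ a := by
  obtain ⟨a, ha, hmod⟩ := exists_descentExponent_dvd_of_even hd
  exact ⟨a, ha, fun τ L F D hF hD hL => class_twist_invariant τ hF hD hL hmod⟩

/-- The same ONE exponent `a` also makes «tensorization with `L_g^{ar+1}`» the identity for every `g`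
(`L_g^{d+1} = 1`): `(L_g ⊗ ·)^[a·8d+1] = id` on any set of objects.
[cite: Markman2025SecantWeil, Lemma 9.3.5 (proof), v2 p. 84 L18–35] -/
theorem lemma935_tensorization_of_even {d : ℕ} (hd : Even d) :
    ∃ a : ℕ, 0 < a ∧ ∀ L : P, L ^ (d + 1) = 1 → (fun F : O => L • F)^[a * (8 * d) + 1] = id := by
  obtain ⟨a, ha, hmod⟩ := exists_descentExponent_dvd_of_even hd
  exact ⟨a, ha, fun L hL => tensorization_iterate_eq_id L hL hmod⟩

/-! ### Numerals (sanity instances; `example`s carry no tag)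

`d = 2`: rank `r = 16`, exponent `n = 3`, `a = 2`, `ar + 1 = 33 = 3·11`; `d = 4`: `r = 32`, `n = 5`, `a = 2`,
`ar + 1 = 65 = 5·13`; `d = 6`: `r = 48`, `n = 7`, `a = 1`, `ar + 1 = 49 = 7·7`. -/

example : (2 + 1) ∣ 2 * (8 * 2) + 1 := by decide
example : (4 + 1) ∣ 2 * (8 * 4) + 1 := by decide
example : (6 + 1) ∣ 1 * (8 * 6) + 1 := by decide
example (L : P) (hL : L ^ 3 = 1) : L ^ (2 * 16 + 1) = 1 := twist_pow_eq_one L hL (by decide)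
example (L : P) (hL : L ^ 7 = 1) : (fun F : O => L • F)^[1 * 48 + 1] = id :=
  tensorization_iterate_eq_id L hL (by decide)

end Proof

end Literature.AlgebraicGeometry.Markman2025.Lemma935
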